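import Summits.ResolutionOfSingularities.ResolutionOfSingularities.Theorems.MarkedTransferCampaignW12SandwichRho
import Summits.ResolutionOfSingularities.ResolutionOfSingularities.Theorems.MarkedTransferCampaignW12SandwichEq59Obstruction
import Summits.ResolutionOfSingularities.ResolutionOfSingularities.Theorems.MarkedTransferCampaignG1PnegaObligationF34Kernel
import Literature.AlgebraicGeometry.Resolution.HasseSchmidtDerivatives
import Mathlib.RingTheory.MvPolynomial.Ideal
import Mathlib.RingTheory.MvPolynomial.Basic
import HarnessLib

/-!
# PART 1 of 2 — [OURS · L1 G1 ℘nega-INTERFACE · calibration kernel] The W1.2 sandwich `℘nega_sw(E,−a)` COMPUTED at the affine-line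
# placement of record (`K[x]`, `𝔪`-adic filtration, class regime `m = p^e`): `℘nega_sw(E,−a) = (x)^{p^e·k(a)}`,
# `k(a)` = the least admissible summand `d` of Eq. (36); consequences for the cells F8⁻ / F3⁻ (and F3hs-bounded) × SW / SWρ

CARRIER NOTE (res-L1-type-o2 g6). KERNEL by res-D-pv-040 (HOME draft `D/res-D-pv-040/PnegaSandwichA1Calibration.draft.lean` rev 2,
sha16 1b103d54d62d6c27, DELIVERED 2026-08-27T03:46:22Z; 515 lines, 31 theorems, 0 defs), carried summit-side VERBATIM and SPLIT at the
author's seam to respect the 400-line cap: THIS file = PART 1 of 2 (§1 span bound · §2 calibration at the affine line · §3 the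
d-climb dies); PART 2 = `MarkedTransferCampaignW12SandwichA1Cells.lean` (§4 F8⁻ cells · §5 F3⁻ cells · §6 Lem 5.9 (1) at base ρ^e
and PW × F8⁻). The overview below describes both parts. [OURS · L1 G1] replaces the role of: nothing printed — scoring kernels for
the OURS candidate W1.2 (SW / SWρ) on the ℘nega-INTERFACE; NOT a statement of the manuscript.

LADDER-RESOLUTION rung L (rescue), cell `res-hironaka`, group G1 (`℘nega`), ℘nega-INTERFACE scoring (instrument
`Campaign.PnegaInterfaceV3` p487629; scorer res-adj-1, table of 2026-08-27T02:46:11Z / 03:19:23Z; res-D-plan-1 ROUTING #12 (a) /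
#13 (a) «S-sized comm-algebra kernels, data level»). D-lane draft by res-D-pv-040 (HOME/D/res-D-pv-040/, carried into the tree
by res-L1-type-o2 as with res-D-pv-031's F3hs kernel). Statement-and-proof file: NO new definition, NO new carrier; every
object is a tree object — `Campaign.sandwichPNega / sandwichPTildeNeg / sandwichDD` (W1.2, p470322), `Campaign.sandwichPNegaRho`
(SWρ, p488714), Mathlib's `MvPolynomial.idealOfVars`, the tree's `Resolution.hasseDeriv` / `IsDiffOpLE` / `diffIdeal`, and the
placement of record `Campaign.PnegaObligation.AffineLine` (res-type-072, p490470: `K[x] = MvPolynomial (Fin 1) K`, `P a = (x)^a`,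
guard `isCharFiltration_idealOfVars_pow`, (37)-pair `(q,g) = (1,x)`).

## What is computed (§2) and why it matters (§3–§5)

Def 5.1 / Eq. (36) p.25 L33–L38 sums `D(m,a,d) = Diff^{(dm+a)} ℘posi(E,dm)` over the RANGE `d·m ≥ |a|`. For the sandwich
(operators of `O/ρ^e(O)`, which are `ρ^e(O)`-linear) at `O = K[x]`, `P j = (x)^j`, `m = p^e`: every summand is
`D_sw(p^e,a,d) = (x)^{d·p^e}` (the source piece `(x^{dp^e}) = ((x^d)^{p^e})` is generated by a `p^e`-th power, so NO relative
operator leaves it — tree `Campaign.W12.diffIdeal_le_span`; and `∂ = id` puts it in), hence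

  `℘nega_sw(E,−a) = (x)^{p^e·k(a)}`,  `k(a) = max(1, ⌈a/p^e⌉)` = the least `d ≥ 1` with `d·p^e ≥ a`   (`sandwichPNega_affineLine_eq`).

So the sandwich pieces SHRINK as the degree `−a` goes to `−∞`: the summand-wise inclusions `D(m,a,d) ⊆ D(m,a+1,d)`
(order-monotonicity, the 02:46:11Z argument for `antitone_nonpos` ✓ and for `diff_mem_neg` ✓c at orders `< p^e`) do not survive
the summation range — the boundary summand `d = a/m` drops out of the range of `a+1`, and the printed repair, the d-CLIMB
`D(m,a,d) ⊆ D(m,a,d′)` for `d ≤ d′` (Lem 5.6 p.27 L1–L2 / Rem 5.7; the binder `hLem5_6` of the tree's `S05NegativePart.Lem5_9_1_of`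
p.28), is exactly what the sandwich kills: `d ↦ D_sw(p^e,1,d) = (x)^{dp^e}` is strictly DEcreasing (`not_monotone_sandwichDD_affineLine`).

Cells decided at this placement (CLASS regime: no negative piece contains a unit, `sandwich_affineLine_not_isUnit`; guard-admissible
and a (37)-placement by res-type-072's `AffineLine` lemmas):
* F8⁻ `antitone_nonpos` × SW: ✗ — `(x)^{p^e} = ℘nega_sw(−p^e) ⊄ ℘nega_sw(−p^e−1) = (x)^{2p^e}` (`not_antitone_nonpos_sandwich_affineLine`,
  literal V3-field shape; ℕ-degree form `not_monotone_sandwichPNega_affineLine`).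
* F8⁻ × SWρ: ✗ — the same two pieces, as sets (`not_monotone_sandwichPNegaRho_affineLine`).
* F3⁻ `diff_mem_neg` × SW: ✗ at EVERY order bound `μ ≥ 1`, already for `D = id` (`not_diff_mem_neg_sandwich_affineLine`,
  `not_diffStable_id_sandwich_affineLine`); and for `μ ≥ p^e` ALSO by the genuinely differential witness `∂^{(μ)} x^μ = 1`
  (`not_diffStable_hasseDeriv_sandwich_affineLine`) — closes the sub-cell «OPEN for μ ≥ p^e» of 02:02:05Z / 03:04:37Z (4).
* INPUT for the bounded Hasse–Schmidt cell F3hs^{<p^e} (ROUTING #13 (a) K13-2, holders res-D-pv-005 / res-type-048 — NOT decided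
  here over their typed predicate): at this placement, `e ≥ 1`, the order-ONE Hasse derivative already fails:
  `x^{p^e+1} ∈ ℘nega_sw(−p^e)`, `∂^{(1)} x^{p^e+1} = x^{p^e} ∉ ℘nega_sw(−p^e−1)` (`not_hasseDerivOne_stable_sandwich_affineLine`;
  module twin on the SWρ carrier p488714: `not_hasseDerivOne_stable_sandwichRho_affineLine`).

* §6 CONSEQUENCES: the typed `S05NegativePart.Lem5_9_1` READ AT BASE `ρ^e(O)` fails here (`not_Lem5_9_1_frobeniusRange_affineLine`) —
  it is the premise of res-type-087's `PowerWitness.negPiece_antitone_of_Lem5_9_1` (K13-3 escape object PW, p492701) — and PW itself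
  fails F8⁻ at this placement: `not_negPiece_le_affineLine`, literal shape `not_antitone_nonpos_powerWitness_affineLine` (answers
  res-D-plan-1 03:44:20Z (3) «F8⁻ ?» with ✗ here).

HONEST FRAMING. Nothing here is a statement of H. Hironaka's manuscript *Resolution of singularities in positive characteristics*
(2017-03-23, [Hironaka2017], lit key `paper:url-3343fd9e678b`); Def 5.1 / Eq. (36) and Lem 5.6 / 5.9 enter only as the SHAPES
re-based on `ρ^e(O)` (OURS rescue candidate W1.2 / SWρ), CANDIDATES [claim: Hironaka2017, status: under-review]. The decisive
read-out of the scorer (SW dead on F1, SWρ dead on F6d-gen) is not touched; this file only corrects two summand-wise ✓ cells to ✗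
and names the mechanism. AI typing/proving is weaker than expert review; nothing here is progress on resolution of singularities
in positive characteristic; no claim beyond the kernel.
-/

noncomputable section

set_option linter.dupNamespace false -- mandated namespace of this single-conjunct summit

namespace Summit.ResolutionOfSingularities.ResolutionOfSingularities.Theorems.Campaign.W12

open MvPolynomial
open Literature.AlgebraicGeometry.Resolution
open Literature.AlgebraicGeometry.Hironaka2017
open Summit.ResolutionOfSingularities.ResolutionOfSingularities.Theorems.Campaign

universe u v

/-! ## §1 The range-restricted Frobenius-span bound (any `O` of characteristic `p`) -/

section AnyRing

variable {O : Type v} [CommRing O] (p : ℕ) [Fact p.Prime] [CharP O p]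

/-- **Range-restricted no-escape bound.** If the source pieces that Eq. (36) actually sums for the degree `−a` — the
`℘posi(E,dm)` with `d ≥ 1` AND `d·m ≥ a` — all lie in an ideal `Q = span S` generated by `p^e`-th powers (`S ⊆ ρ^e(O)`), then
`℘nega_sw(E,−a) ⊆ Q` (relative operators are `ρ^e(O)`-linear: tree `Campaign.W12.diffIdeal_le_span`). Refines the tree's
`sandwichPNega_le_span_of_mul` (p468852), which asks the bound for every `d ≥ 1`; the range `d·m ≥ a` is what makes the
sandwich pieces shrink with `a`. [folklore] -/
theorem sandwichPNega_le_span_of_range (e : ℕ) {S : Set O} (hS : S ⊆ Set.range (iterateFrobenius O p e))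
    {P : ℕ → Ideal O} {m a : ℕ}
    (hP : ∀ d : ℕ, 0 < d → a ≤ d * m → S05NegativePart.pPosi P (d * m) ≤ Ideal.span S) :
    sandwichPNega p e P m a ≤ Ideal.span S := by
  unfold sandwichPNega S05NegativePart.pNega S05NegativePart.pTildeNeg
  refine iSup₂_le fun d hd => ?_
  unfold S05NegativePart.DD
  refine diffIdeal_le_span e _ hS ?_
  rcases le_or_gt d 0 with hd0 | hd0
  · have h0 : (d * (m : ℤ)).toNat = 0 :=
      Int.toNat_eq_zero.mpr (mul_nonpos_of_nonpos_of_nonneg hd0 (by positivity))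
    rw [h0]
    simp [S05NegativePart.pPosi]
  · obtain ⟨k, rfl⟩ := Int.eq_ofNat_of_zero_le hd0.le
    have hk : ((k : ℤ) * (m : ℤ)).toNat = k * m := by
      rw [← Nat.cast_mul, Int.toNat_natCast]
    rw [hk]
    have hkpos : 0 < k := by exact_mod_cast hd0
    have hakm : a ≤ k * m := by
      rw [Nat.abs_cast] at hd
      exact_mod_cast hd
    exact hP k hkpos hakm

end AnyRing

/-! ## §2 The affine-line placement of record: `K[x] = MvPolynomial (Fin 1) K`, `P a = (x)^a`, `m = p^e` -/

section AffineLine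

variable (K : Type u) [Field K] (p : ℕ) [Fact p.Prime] [CharP K p]

/-- In one variable `(x_i : i ∈ Fin 1) = {x}`. [folklore] -/
theorem range_X_fin_one : Set.range (X : Fin 1 → MvPolynomial (Fin 1) K) = {X 0} := by
  ext f
  simp only [Set.mem_range, Set.mem_singleton_iff]
  constructor
  · rintro ⟨i, rfl⟩
    rw [Subsingleton.elim i 0]
  · rintro rfl
    exact ⟨0, rfl⟩

/-- `𝔪^n = (x^n)` in `K[x]`. [folklore] -/
theorem idealOfVars_fin_one_pow (n : ℕ) :
    idealOfVars (Fin 1) K ^ n = Ideal.span {(X 0 : MvPolynomial (Fin 1) K) ^ n} := by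
  show Ideal.span (Set.range X) ^ n = _
  rw [range_X_fin_one, Ideal.span_singleton_pow]

/-- `x^j ∈ 𝔪^n ↔ n ≤ j`. [folklore] -/
theorem X_pow_mem_idealOfVars_pow_iff (n j : ℕ) :
    (X 0 : MvPolynomial (Fin 1) K) ^ j ∈ idealOfVars (Fin 1) K ^ n ↔ n ≤ j := by
  rw [X_pow_eq_monomial, monomial_mem_pow_idealOfVars_iff n _ (one_ne_zero' K), Finsupp.degree_single]

/-- `1 ∉ 𝔪^n` for `n ≠ 0`. [folklore] -/
theorem one_not_mem_idealOfVars_pow {n : ℕ} (hn : n ≠ 0) :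
    (1 : MvPolynomial (Fin 1) K) ∉ idealOfVars (Fin 1) K ^ n := by
  rw [← C_1, C_mem_pow_idealOfVars_iff, not_or]
  exact ⟨one_ne_zero, hn⟩

/-- `p^e ≠ 0`. [folklore] -/
theorem pow_prime_ne_zero (e : ℕ) : p ^ e ≠ 0 := pow_ne_zero e (Fact.out : p.Prime).ne_zero

/-- Degree bookkeeping (by `rfl`): the `ℤ`-indexed sandwich piece at a natural index `a` IS `℘nega_sw(E,−a)`. [folklore] -/
theorem sandwichPTildeNeg_natCast {O : Type v} [CommRing O] [CharP O p] (e : ℕ) (P : ℕ → Ideal O) (m a : ℕ) :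
    sandwichPTildeNeg p e P m (a : ℤ) = sandwichPNega p e P m a :=
  rfl

/-- **Upper calibration.** At `P a = (x)^a`, `m = p^e`: if every admissible summand index `d ≥ 1` with `d·p^e ≥ a` is `≥ k`,
then `℘nega_sw(E,−a) ⊆ (x)^{k·p^e}` — each summed source piece `(x)^{dp^e} ⊆ (x^{kp^e}) = ((x^k)^{p^e})` is a Frobenius span
which no operator of `O/ρ^e(O)` leaves (§1). [folklore] -/
theorem sandwichPNega_affineLine_le (e a k : ℕ) (hmin : ∀ d : ℕ, 0 < d → a ≤ d * p ^ e → k ≤ d) :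
    sandwichPNega p e (fun j => idealOfVars (Fin 1) K ^ j) (p ^ e) a ≤ idealOfVars (Fin 1) K ^ (k * p ^ e) := by
  rw [idealOfVars_fin_one_pow]
  refine sandwichPNega_le_span_of_range p e ?_ ?_
  · rintro _ ⟨⟩
    exact ⟨X 0 ^ k, by rw [iterateFrobenius_def, ← pow_mul]⟩
  · intro d hd had
    have hdm : d * p ^ e ≠ 0 := Nat.mul_ne_zero hd.ne' (pow_prime_ne_zero p e)
    simp only [S05NegativePart.pPosi, if_neg hdm]
    rw [← idealOfVars_fin_one_pow]
    exact Ideal.pow_le_pow_right (Nat.mul_le_mul_right _ (hmin d hd had))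

/-- **Lower calibration** (`∂ = id`, tree `Campaign.W12.le_sandwichPNega`): `(x)^{k·p^e} = ℘(E,k·m) ⊆ ℘nega_sw(E,−a)` for
`k ≥ 1`, `a ≤ k·p^e`. [folklore] -/
theorem le_sandwichPNega_affineLine (e a k : ℕ) (hk : 0 < k) (ha : a ≤ k * p ^ e) :
    idealOfVars (Fin 1) K ^ (k * p ^ e) ≤ sandwichPNega p e (fun j => idealOfVars (Fin 1) K ^ j) (p ^ e) a :=
  le_sandwichPNega p e (fun j => idealOfVars (Fin 1) K ^ j) (m := p ^ e) (a := a) (d := k) ha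
    (Nat.mul_ne_zero hk.ne' (pow_prime_ne_zero p e))

/-- **THE CALIBRATION.** At the affine-line placement (`K[x]`, `P a = (x)^a`) in the class regime `m = p^e`:
`℘nega_sw(E,−a) = (x)^{k·p^e}` where `k ≥ 1` is the LEAST admissible summand index of Eq. (36) (`a ≤ k·p^e`, and every
`d ≥ 1` with `a ≤ d·p^e` is `≥ k`), i.e. `k = max(1, ⌈a/p^e⌉)`. [folklore] -/
theorem sandwichPNega_affineLine_eq (e a k : ℕ) (hk : 0 < k) (ha : a ≤ k * p ^ e)
    (hmin : ∀ d : ℕ, 0 < d → a ≤ d * p ^ e → k ≤ d) :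
    sandwichPNega p e (fun j => idealOfVars (Fin 1) K ^ j) (p ^ e) a = idealOfVars (Fin 1) K ^ (k * p ^ e) :=
  le_antisymm (sandwichPNega_affineLine_le K p e a k hmin) (le_sandwichPNega_affineLine K p e a k hk ha)

/-- Instance `k = 1`: `℘nega_sw(E,−a) = (x)^{p^e}` for every `a ≤ p^e` (in particular `a = 0, 1, …, p^e`). [folklore] -/
theorem sandwichPNega_affineLine_eq_one (e a : ℕ) (ha : a ≤ p ^ e) :
    sandwichPNega p e (fun j => idealOfVars (Fin 1) K ^ j) (p ^ e) a = idealOfVars (Fin 1) K ^ (p ^ e) := by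
  have h := sandwichPNega_affineLine_eq K p e a 1 one_pos (by simpa using ha) (fun d hd _ => hd)
  simpa using h

/-- Instance `k = 2`: `℘nega_sw(E,−a) = (x)^{2p^e}` for `p^e < a ≤ 2p^e`. [folklore] -/
theorem sandwichPNega_affineLine_eq_two (e a : ℕ) (h1 : p ^ e < a) (h2 : a ≤ 2 * p ^ e) :
    sandwichPNega p e (fun j => idealOfVars (Fin 1) K ^ j) (p ^ e) a = idealOfVars (Fin 1) K ^ (2 * p ^ e) := by
  refine sandwichPNega_affineLine_eq K p e a 2 two_pos h2 fun d hd had => ?_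
  by_contra hlt
  have hd1 : d ≤ 1 := by omega
  have : d * p ^ e ≤ 1 * p ^ e := Nat.mul_le_mul_right _ hd1
  omega

/-- The uniform bound: `℘nega_sw(E,−a) ⊆ (x)^{p^e}` for EVERY `a` (every admissible `d` is `≥ 1`). [folklore] -/
theorem sandwichPNega_affineLine_le_one (e a : ℕ) :
    sandwichPNega p e (fun j => idealOfVars (Fin 1) K ^ j) (p ^ e) a ≤ idealOfVars (Fin 1) K ^ (p ^ e) := by
  simpa using sandwichPNega_affineLine_le K p e a 1 (fun d hd _ => hd)

/-- … and `℘nega_sw(E,−a) ⊆ (x)^{2p^e}` for every `a > p^e` (every admissible `d` is `≥ 2`). [folklore] -/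
theorem sandwichPNega_affineLine_le_two (e a : ℕ) (h1 : p ^ e < a) :
    sandwichPNega p e (fun j => idealOfVars (Fin 1) K ^ j) (p ^ e) a ≤ idealOfVars (Fin 1) K ^ (2 * p ^ e) := by
  refine sandwichPNega_affineLine_le K p e a 2 fun d hd had => ?_
  by_contra hlt
  have hd1 : d ≤ 1 := by omega
  have : d * p ^ e ≤ 1 * p ^ e := Nat.mul_le_mul_right _ hd1
  omega

/-- **CLASS regime (F7b-unit ✓ here):** no sandwich negative piece at this placement contains a unit — all of them lie in
`(x)^{p^e} ⊆ 𝔪`. So the failures below are NOT box-regime artefacts. [folklore] -/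
theorem sandwich_affineLine_not_isUnit (e a : ℕ) {u : MvPolynomial (Fin 1) K} (hu : IsUnit u) :
    u ∉ sandwichPNega p e (fun j => idealOfVars (Fin 1) K ^ j) (p ^ e) a := by
  intro hmem
  have h1 : (1 : MvPolynomial (Fin 1) K) ∈ idealOfVars (Fin 1) K ^ (p ^ e) :=
    (Ideal.eq_top_iff_one _).mp (Ideal.eq_top_of_isUnit_mem _ (sandwichPNega_affineLine_le_one K p e a hmem) hu)
  exact one_not_mem_idealOfVars_pow K (pow_prime_ne_zero p e) h1

/-- The placement is guard-admissible and carries the (37)-pair `(q,g) = (1,x)` (res-type-072's `AffineLine` lemmas, restated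
as one conjunction for the scorer: `IsCharFiltration`, `x ∈ P 1`, `Diff^{(k)}(x^k) = ⊤` for `k > 0`, `P 1 ≠ ⊤`). [folklore] -/
theorem affineLine_placement :
    IsCharFiltration K (fun a : ℕ => idealOfVars (Fin 1) K ^ a) ∧
      (X 0 : MvPolynomial (Fin 1) K) ∈ idealOfVars (Fin 1) K ^ 1 ∧
      (∀ k : ℕ, 0 < k → diffIdeal K (k * 1) (Ideal.span {(X 0 : MvPolynomial (Fin 1) K) ^ k}) = ⊤) ∧
      idealOfVars (Fin 1) K ^ 1 ≠ ⊤ :=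
  ⟨PnegaObligation.AffineLine.isCharFiltration_idealOfVars_pow K, PnegaObligation.AffineLine.X_mem_idealOfVars_pow_one K,
    PnegaObligation.AffineLine.diffIdeal_span_X_pow_eq_top K,
    fun h => one_not_mem_idealOfVars_pow K one_ne_zero ((Ideal.eq_top_iff_one _).mp h)⟩

/-! ## §3 The d-climb dies: `d ↦ D_sw(p^e,a,d)` is DEcreasing (the binder `hLem5_6` of `Lem5_9_1_of` fails at base `ρ^e(O)`) -/

/-- Relative operators do not move a Frobenius-generated power of `𝔪`: `Diff^{(n)}_{O/ρ^e(O)}·(x)^{k·p^e} = (x)^{k·p^e}` for every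
order `n`. [folklore] -/
theorem diffIdeal_frobeniusRange_idealOfVars_pow (e k n : ℕ) :
    diffIdeal (↥(iterateFrobenius (MvPolynomial (Fin 1) K) p e).range) n (idealOfVars (Fin 1) K ^ (k * p ^ e)) =
      idealOfVars (Fin 1) K ^ (k * p ^ e) := by
  refine le_antisymm ?_ (le_diffIdeal _ n _)
  rw [idealOfVars_fin_one_pow]
  refine diffIdeal_le_span e n ?_ le_rfl
  rintro _ ⟨⟩
  exact ⟨X 0 ^ k, by rw [iterateFrobenius_def, ← pow_mul]⟩

/-- **The summands of Eq. (36) at base `ρ^e(O)`, computed:** `D_sw(p^e,a,d) = (x)^{d·p^e}` for every `d ≥ 1` and every `a : ℤ`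
(inside the printed range `d·p^e + a ≥ 0` this is the genuine summand; outside it is row 008's junk value, equal to the same
ideal because NO relative operator of any order moves `(x)^{dp^e}`). [folklore] -/
theorem sandwichDD_affineLine_eq (e : ℕ) (a : ℤ) (d : ℕ) (hd : 0 < d) :
    sandwichDD p e (fun j => idealOfVars (Fin 1) K ^ j) (p ^ e) a d = idealOfVars (Fin 1) K ^ (d * p ^ e) := by
  unfold sandwichDD S05NegativePart.DD
  have h1 : ((d : ℤ) * ((p ^ e : ℕ) : ℤ)).toNat = d * p ^ e := by
    rw [← Nat.cast_mul, Int.toNat_natCast]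
  have hdm : d * p ^ e ≠ 0 := Nat.mul_ne_zero hd.ne' (pow_prime_ne_zero p e)
  rw [h1]
  simp only [S05NegativePart.pPosi, if_neg hdm]
  exact diffIdeal_frobeniusRange_idealOfVars_pow K p e d _

/-- **The d-climb of Lem 5.6 / Rem 5.7 FAILS for the sandwich** (the exact binder `hLem5_6 : ∀ a > 0, Monotone (d ↦ D(m,a,d))`
of the tree's `S05NegativePart.Lem5_9_1_of`, read at base `ρ^e(O)`): at `a = 1`, `D_sw(p^e,1,1) = (x)^{p^e} ⊄ D_sw(p^e,1,2) =
(x)^{2p^e}`. [folklore] -/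
theorem not_monotone_sandwichDD_affineLine (e : ℕ) :
    ¬ ∀ a : ℤ, 0 < a → Monotone (fun d : ℤ =>
      S05NegativePart.DD (↥(iterateFrobenius (MvPolynomial (Fin 1) K) p e).range)
        (fun j => idealOfVars (Fin 1) K ^ j) (p ^ e) a d) := by
  intro h
  have h12 := h 1 one_pos (show (1 : ℤ) ≤ 2 by norm_num)
  have e1 := sandwichDD_affineLine_eq K p e 1 1 one_pos
  have e2 := sandwichDD_affineLine_eq K p e 1 2 two_pos
  unfold sandwichDD at e1 e2
  simp only [Nat.cast_one, Nat.cast_ofNat] at e1 e2 h12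
  rw [e1, e2] at h12
  have hmem : (X 0 : MvPolynomial (Fin 1) K) ^ p ^ e ∈ idealOfVars (Fin 1) K ^ (1 * p ^ e) := by
    rw [X_pow_mem_idealOfVars_pow_iff]; omega
  have := (X_pow_mem_idealOfVars_pow_iff K (2 * p ^ e) (p ^ e)).mp (h12 hmem)
  have hq : 0 < p ^ e := Nat.pos_of_ne_zero (pow_prime_ne_zero p e)
  omega

end AffineLine

end Summit.ResolutionOfSingularities.ResolutionOfSingularities.Theorems.Campaign.W12
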